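import Summits.CriticalPhenomena.PercolationContinuityZ3.Theorems.Transplant.FKDoubleFanSesquiConeCross
import Summits.CriticalPhenomena.PercolationContinuityZ3.Theorems.Transplant.FKDoubleFanSesquiConeCrossRays
import HarnessLib

/-!
# Double fans `K₂ ∨ P_{m+1}`: the local criterion for the dressed cone holds UNCONDITIONALLY on the closure of the undressed (single-fan) atoms

Helper file (`--supports stmt-CriticalPhenomena-4575`), FK sub-lane `prim-bschramm-fk-3` (gen 43); builds on p205010 (kernel theorem, internal
audit signed; external expert review pending).  No named facts, no sorries; standard axioms.  Memo `bschramm/prim-bschramm-fk-3/FAR-CROSS-XVIII.md` §3.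

`…SesquiConeCross`: `Hyp15A ∧ Hyp15B ⟺ CrossPosD15 q` — `⟪T_D β, ρ⟫ ≥ 0` for every `β ∈ atomClosure15 q` (closure of the normalised dressed atoms)
and every `ρ ∈ DualS15 q` with `⟪β, ρ⟫ = 0`.  The sub-closure `atomClosure2 q ⊆ atomClosure15 q` of the UNDRESSED single-fan images
(`…TwoSidedConeSCrossA`) carries no content: fans absorb rim steps (`∧²E_r·imgA q F w = imgA q (E_r F) w`, `opE_imgA`, `opE_imgB`), so every rim step maps
`atomClosure2 q` into `cone15 q` (**`opE_ofFun_mem_cone15_of_mem_atomClosure2`**, closure argument), and the first-order expansion of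
`⟪∧²E_r β, ρ⟫ ≥ 0` at `r = 1` gives **`crossPosD_of_mem_atomClosure2`**: the criterion holds at every `β ∈ atomClosure2 q` for every `q` — no
hypothesis.  Together with `…SesquiConeCrossRays` (the fully dressed rays) this settles `CrossPosD15` on the two extreme layers `s = 0` (with its
limit points) and `s = 1` of the dressed families; the content of `Hyp15` is the layer `0 < s < 1` at the relative boundary of the families
(memo §2).  Also recorded: **`atomSet2_subset_atomSet15`**, **`atomClosure2_subset_atomClosure15`** (the undressed atoms are the `x = 0` / `y = 0`
dressed atoms). [folklore]
-/

noncomputable section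

open Filter Topology

namespace Summit.CriticalPhenomena.PercolationContinuityZ3.Theorems

namespace FK

namespace ThreeApex

/-- The undressed atoms are dressed atoms with spoke weight `0`. [folklore] -/
theorem atomSet2_subset_atomSet15 (q : ℝ) : atomSet2 q ⊆ atomSet15 q := by
  rintro v (⟨F, w, hF, hw, hne, rfl⟩ | ⟨G, w, hG, hw, hne, rfl⟩)
  · refine Or.inr ⟨F, w, 0, hF, hw, le_rfl, zero_le_one, ?_, ?_⟩ <;> rw [opBC_zero]
    exact hne
  · refine Or.inl ⟨G, w, 0, hG, hw, le_rfl, zero_le_one, ?_, ?_⟩ <;> rw [opAC_zero]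
    exact hne

/-- Hence the closures are nested. [folklore] -/
theorem atomClosure2_subset_atomClosure15 (q : ℝ) : atomClosure2 q ⊆ atomClosure15 q :=
  closure_mono (atomSet2_subset_atomSet15 q)

/-- **Rim steps map the closure of the undressed atoms into the dressed cone** — unconditionally (`0 < q ≤ 1`, `r ∈ [0,1]`): fans absorb
rim steps. [folklore] -/
theorem opE_ofFun_mem_cone15_of_mem_atomClosure2 {q : ℝ} (hq0 : 0 < q) (hq1 : q ≤ 1) {r : ℝ} (hr0 : 0 ≤ r) (hr1 : r ≤ 1) :
    ∀ v ∈ atomClosure2 q, opE q r (Biv.ofFun v) ∈ cone15 q := by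
  intro v hv γ hγ
  have hcl : IsClosed {v : Fin 10 → ℝ | 0 ≤ pairH q (opE q r (Biv.ofFun v)) γ} := by
    have : Continuous fun v : Fin 10 → ℝ => pairH q (opE q r (Biv.ofFun v)) γ := by
      simp only [pairH_opE]; exact continuous_pairH_ofFun q _
    exact isClosed_le continuous_const this
  refine closure_minimal ?_ hcl hv
  rintro v (⟨F, w, hF, hw, hne, rfl⟩ | ⟨G, w, hG, hw, hne, rfl⟩)
  · show 0 ≤ pairH q (opE q r (Biv.ofFun (‖Biv.toFun (imgA q F w)‖⁻¹ • Biv.toFun (imgA q F w)))) γ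
    rw [Biv.ofFun_smul, Biv.ofFun_toFun, pairH_opE, pairH_smul_left, ← pairH_opE, opE_imgA]
    exact mul_nonneg (inv_nonneg.2 (norm_nonneg _)) (imgA_mem_cone15 (hF.rimStep hq0 hq1 hr0 hr1) hw γ hγ)
  · show 0 ≤ pairH q (opE q r (Biv.ofFun (‖Biv.toFun (imgB q G w)‖⁻¹ • Biv.toFun (imgB q G w)))) γ
    rw [Biv.ofFun_smul, Biv.ofFun_toFun, pairH_opE, pairH_smul_left, ← pairH_opE, opE_imgB]
    exact mul_nonneg (inv_nonneg.2 (norm_nonneg _)) (imgB_mem_cone15 (hG.rimStep hq0 hq1 hr0 hr1) hw γ hγ)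

/-- **The local criterion holds unconditionally on the closure of the undressed atoms**: for `β ∈ atomClosure2 q`, `ρ ∈ DualS15 q`,
`⟪β, ρ⟫ = 0` ⟹ `⟪T_D β, ρ⟫ ≥ 0` (`0 < q ≤ 1`). [folklore] -/
theorem crossPosD_of_mem_atomClosure2 {q : ℝ} (hq0 : 0 < q) (hq1 : q ≤ 1) :
    ∀ v ∈ atomClosure2 q, ∀ ρ : Biv, DualS15 q ρ → pairH q (Biv.ofFun v) ρ = 0 → 0 ≤ pairH q (opTD q (Biv.ofFun v)) ρ := by
  intro v hv ρ hρ h0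
  set β := Biv.ofFun v with hβ
  have hg : ∀ r : ℝ, 0 ≤ r → r ≤ 1 → 0 ≤ r * (1 - r) * pairH q (opTD q β) ρ + (1 - r) ^ 2 * pairH q (opWD q β) ρ := by
    intro r hr0 hr1
    have := opE_ofFun_mem_cone15_of_mem_atomClosure2 hq0 hq1 hr0 hr1 v hv ρ hρ
    rwa [pairH_opE_poly, h0, mul_zero, zero_add] at this
  -- with δ := 1 − r: δ(1−δ)·T + δ²·W ≥ 0 on (0,1], i.e. δ·T + δ²·(W − T) ≥ 0
  refine nonneg_of_quadratic_curve (A := pairH q (opTD q β) ρ) (B := pairH q (opWD q β) ρ - pairH q (opTD q β) ρ) ?_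
  intro δ hδ0 hδ1
  have := hg (1 - δ) (by linarith) (by linarith)
  have e : (1 - δ) * (1 - (1 - δ)) * pairH q (opTD q β) ρ + (1 - (1 - δ)) ^ 2 * pairH q (opWD q β) ρ =
      δ * pairH q (opTD q β) ρ + δ ^ 2 * (pairH q (opWD q β) ρ - pairH q (opTD q β) ρ) := by ring
  linarith [e ▸ this]

end ThreeApex

end FK

end Summit.CriticalPhenomena.PercolationContinuityZ3.Theorems
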